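import Summits.ResolutionOfSingularities.ResolutionOfSingularities.Theorems.PurelyInseparableDim4AtlasMemberDefsFour
import Summits.ResolutionOfSingularities.ResolutionOfSingularities.Theorems.PurelyInseparableDim4AtlasRootShear
import HarnessLib

/-!
# Purely inseparable four-folds: the SHEAR OF RECORD of an atlas member with letters — `MemberAtlasZL` survives the admissible shear of
# every reading (brick S3 (c) v4, tranche 2, brick G2; cell `res-dim4-pi`)

[OURS · counted 0] (D-0157 DOOR 2; host item stmt-ResolutionOfSingularities-16155, helper). Nothing here proves resolution of
singularities in dimension ≥ 4 / characteristic `p`. G1 (`zigzag_shear_reading`, p725696) at the level of the tranche-2 member datum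
(`…AtlasMemberDefsFour`): the one-pivot shear `shearFun T j β` is a `K`-automorphism of `K[x₁..x₄]` (inverse: `−β`); under `ShearOK T L (j, β)`
it maps `(x_T)` into itself both ways and fixes every letter of `L` and every variable off `T`; hence a member carrying `MemberAtlasZL` for
readings `R` (letters complete, deferral and bundle indices off the centre, order `≥ 1` along the centre) carries `MemberAtlasZL` for the
SHEARED readings `(shearReading shr r.1, r.2)` — same zigzag sources, `ψ` composed with the lift of the shear, same letters, same owned sets.

* `exists_algEquiv_shearFun`, `shearFun_fixes_of_shearOK`, `shearState_basics`, **`memberAtlasZL_shear`** (G2).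

AI-produced formalisation, weaker than expert review. bears_on: LADDER-RESOLUTION:D157-DOOR2 (res-dim4-pi · S3 (c) v4 tranche 2 G2).
-/

set_option linter.dupNamespace false -- D-0017: single-problem summit path `Summit.<S>.<S>.…` by design

noncomputable section

open MvPolynomial Finset CategoryTheory AlgebraicGeometry Opposite TopologicalSpace
open AlgebraicGeometry.Scheme.IdealSheafData (ofIdealTop vanishingIdeal)

namespace Summit.ResolutionOfSingularities.ResolutionOfSingularities.Theorems.PIDim4

open Literature.AlgebraicGeometry.Resolution
open Literature.AlgebraicGeometry.Resolution.Hauser2010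
open Literature.AlgebraicGeometry.Resolution.AffinePointBlowup (P A γ coord Wtop ξ)

namespace Equimultiple

section ShearMember

variable {K : Type} [Field K] {p : ℕ} [hp : Fact p.Prime] [CharP K p] [DecidableEq K]

omit hp [CharP K p] [DecidableEq K] in
/-- **The one-pivot shear is an automorphism**: `τ F = aeval (shearFun T j β) F` for a `K`-automorphism `τ` with `τ x_j = x_j`,
`τ x_i = x_i + β_i x_j` (`i ∈ T ∖ {j}`), `τ x_i = x_i` otherwise, and `τ⁻¹ x_i = x_i − β_i x_j` resp. `x_i`.
[cite: HauserPerlega2019PRIMS, §2 (linear coordinate changes)] -/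
theorem exists_algEquiv_shearFun (T : Finset (Fin 4)) (j : Fin 4) (β : Fin 4 → K) :
    ∃ τ : MvPolynomial (Fin 4) K ≃ₐ[K] MvPolynomial (Fin 4) K,
      (∀ F : MvPolynomial (Fin 4) K, τ F = aeval (shearFun T j β) F) ∧
      (∀ i : Fin 4, i ∈ T → i ≠ j → τ (X i) = X i + C (β i) * X j) ∧ (∀ i : Fin 4, ¬ (i ∈ T ∧ i ≠ j) → τ (X i) = X i) ∧
      (∀ i : Fin 4, i ∈ T → i ≠ j → τ.symm (X i) = X i - C (β i) * X j) ∧ (∀ i : Fin 4, ¬ (i ∈ T ∧ i ≠ j) → τ.symm (X i) = X i) := by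
  classical
  let f : Fin 4 → MvPolynomial (Fin 4) K := shearFun T j β
  let f' : Fin 4 → MvPolynomial (Fin 4) K := fun i => if i ∈ T ∧ i ≠ j then X i - C (β i) * X j else X i
  have hfj : aeval f (X j : MvPolynomial (Fin 4) K) = X j := by
    rw [aeval_X]; change (if j ∈ T ∧ j ≠ j then _ else _) = _; rw [if_neg (fun h => h.2 rfl)]
  have hf'j : aeval f' (X j : MvPolynomial (Fin 4) K) = X j := by
    rw [aeval_X]; change (if j ∈ T ∧ j ≠ j then _ else _) = _; rw [if_neg (fun h => h.2 rfl)]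
  have h1 : (aeval f).comp (aeval f') = AlgHom.id K (MvPolynomial (Fin 4) K) := by
    refine MvPolynomial.algHom_ext fun i => ?_
    rw [AlgHom.comp_apply, AlgHom.id_apply, aeval_X]
    change aeval f (if i ∈ T ∧ i ≠ j then X i - C (β i) * X j else X i) = X i
    by_cases hi : i ∈ T ∧ i ≠ j
    · rw [if_pos hi, map_sub, map_mul, aeval_C, hfj, aeval_X, algebraMap_eq]
      change (if i ∈ T ∧ i ≠ j then X i + C (β i) * X j else X i) - _ = _
      rw [if_pos hi]; ring
    · rw [if_neg hi, aeval_X]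
      change (if i ∈ T ∧ i ≠ j then X i + C (β i) * X j else X i) = _
      rw [if_neg hi]
  have h2 : (aeval f').comp (aeval f) = AlgHom.id K (MvPolynomial (Fin 4) K) := by
    refine MvPolynomial.algHom_ext fun i => ?_
    rw [AlgHom.comp_apply, AlgHom.id_apply, aeval_X]
    change aeval f' (if i ∈ T ∧ i ≠ j then X i + C (β i) * X j else X i) = X i
    by_cases hi : i ∈ T ∧ i ≠ j
    · rw [if_pos hi, map_add, map_mul, aeval_C, hf'j, aeval_X, algebraMap_eq]
      change (if i ∈ T ∧ i ≠ j then X i - C (β i) * X j else X i) + _ = _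
      rw [if_pos hi]; ring
    · rw [if_neg hi, aeval_X]
      change (if i ∈ T ∧ i ≠ j then X i - C (β i) * X j else X i) = _
      rw [if_neg hi]
  refine ⟨AlgEquiv.ofAlgHom (aeval f) (aeval f') h1 h2, fun F => rfl, fun i hi hij => ?_, fun i hi => ?_, fun i hi hij => ?_,
    fun i hi => ?_⟩
  · change aeval f (X i) = _
    rw [aeval_X]; change (if i ∈ T ∧ i ≠ j then X i + C (β i) * X j else X i) = _; rw [if_pos ⟨hi, hij⟩]
  · change aeval f (X i) = _
    rw [aeval_X]; change (if i ∈ T ∧ i ≠ j then X i + C (β i) * X j else X i) = _; rw [if_neg hi]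
  · change aeval f' (X i) = _
    rw [aeval_X]; change (if i ∈ T ∧ i ≠ j then X i - C (β i) * X j else X i) = _; rw [if_pos ⟨hi, hij⟩]
  · change aeval f' (X i) = _
    rw [aeval_X]; change (if i ∈ T ∧ i ≠ j then X i - C (β i) * X j else X i) = _; rw [if_neg hi]

omit hp [CharP K p] in
/-- **Under `ShearOK` the shear preserves `(x_T)` both ways and fixes the letters and the variables off `T ∖ {j}`.**
[cite: BierstoneGrigorievMilmanWlodarczyk2011, §4 Step 2b] -/
theorem shearFun_fixes_of_shearOK {T : Finset (Fin 4)} {L : Finset (Fin 4 × K)} {jβ : Fin 4 × (Fin 4 → K)} (hOK : ShearOK T L jβ)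
    (hfmt : ∀ ic ∈ L, ic.1 ∈ T → ic.2 = 0)
    (τ : MvPolynomial (Fin 4) K ≃ₐ[K] MvPolynomial (Fin 4) K)
    (h1 : ∀ i : Fin 4, i ∈ T → i ≠ jβ.1 → τ (X i) = X i + C (jβ.2 i) * X jβ.1) (h2 : ∀ i : Fin 4, ¬ (i ∈ T ∧ i ≠ jβ.1) → τ (X i) = X i)
    (h3 : ∀ i : Fin 4, i ∈ T → i ≠ jβ.1 → τ.symm (X i) = X i - C (jβ.2 i) * X jβ.1)
    (h4 : ∀ i : Fin 4, ¬ (i ∈ T ∧ i ≠ jβ.1) → τ.symm (X i) = X i) :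
    (∀ i ∈ T, τ (X i) ∈ Ideal.span (X '' (T : Set (Fin 4)) : Set (MvPolynomial (Fin 4) K))) ∧
    (∀ i ∈ T, τ.symm (X i) ∈ Ideal.span (X '' (T : Set (Fin 4)) : Set (MvPolynomial (Fin 4) K))) ∧
    (∀ ic ∈ L, τ (X ic.1) = X ic.1) ∧ (∀ i : Fin 4, i ∉ T → τ (X i) = X i) := by
  obtain ⟨hact, hoff, hlet⟩ := hOK
  have hXi : ∀ i ∈ T, (X i : MvPolynomial (Fin 4) K) ∈ Ideal.span (X '' (T : Set (Fin 4)) : Set (MvPolynomial (Fin 4) K)) :=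
    fun i hi => Ideal.subset_span ⟨i, hi, rfl⟩
  -- if the shear is active at `i`, the pivot lies in `T`
  have hpiv : ∀ i ∈ T, i ≠ jβ.1 → jβ.2 i ≠ 0 → jβ.1 ∈ T := fun i hi hij hβ => hact ⟨i, hi, hij, hβ⟩
  refine ⟨fun i hi => ?_, fun i hi => ?_, fun ic hic => ?_, fun i hi => h2 i (fun h => hi h.1)⟩
  · by_cases hij : i = jβ.1
    · rw [h2 i (fun h => h.2 hij)]; exact hXi i hi
    · rw [h1 i hi hij]
      by_cases hβ : jβ.2 i = 0
      · rw [hβ, C_0, zero_mul, add_zero]; exact hXi i hi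
      · exact Ideal.add_mem _ (hXi i hi) (Ideal.mul_mem_left _ _ (hXi _ (hpiv i hi hij hβ)))
  · by_cases hij : i = jβ.1
    · rw [h4 i (fun h => h.2 hij)]; exact hXi i hi
    · rw [h3 i hi hij]
      by_cases hβ : jβ.2 i = 0
      · rw [hβ, C_0, zero_mul, sub_zero]; exact hXi i hi
      · exact Ideal.sub_mem _ (hXi i hi) (Ideal.mul_mem_left _ _ (hXi _ (hpiv i hi hij hβ)))
  · by_cases h : ic.1 ∈ T ∧ ic.1 ≠ jβ.1
    · rw [h1 ic.1 h.1 h.2, hlet ic hic h.1 (hfmt ic hic h.1), C_0, zero_mul, add_zero]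
    · exact h2 ic.1 h

/-- **Basics of a sheared state**: for `F ≠ 0` clean and `T`-permissible and an admissible shear, `clean(σ F)` is `≠ 0`, clean and
`T`-permissible. [cite: HauserPerlega2019PRIMS, §2] -/
theorem shearState_basics [IsAlgClosed K] {T : Finset (Fin 4)} {L : Finset (Fin 4 × K)} {jβ : Fin 4 × (Fin 4 → K)}
    (hOK : ShearOK T L jβ) (hfmt : ∀ ic ∈ L, ic.1 ∈ T → ic.2 = 0) (s : State K) (hF : s.F ≠ 0)
    (hclean : Literature.Barriers.ResolutionOfSingularities.HauserPerlega.IsClean p s.F) (hperm : IsPermissibleCentre p T s.F) :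
    (shearState p T jβ s).F ≠ 0 ∧ Literature.Barriers.ResolutionOfSingularities.HauserPerlega.IsClean p (shearState p T jβ s).F ∧
      IsPermissibleCentre p T (shearState p T jβ s).F := by
  haveI : PerfectRing K p := PerfectRing.ofSurjective K p fun x => IsAlgClosed.exists_pow_nat_eq x hp.out.pos
  obtain ⟨τ, hτF, h1, h2, h3, h4⟩ := exists_algEquiv_shearFun (K := K) T jβ.1 jβ.2
  obtain ⟨hτ, -, -, -⟩ := shearFun_fixes_of_shearOK hOK hfmt τ h1 h2 h3 h4
  have hF' : (shearState p T jβ s).F = deletePthPowers p (τ s.F) := by rw [hτF]; rfl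
  rw [hF']
  refine ⟨deletePthPowers_map_ne_zero_of_isClean τ hF hclean, isClean_deletePthPowers _, hperm.1, ?_⟩
  exact le_trans (le_ordAlong_map_of_forall_mem_span (τ : MvPolynomial (Fin 4) K →ₐ[K] MvPolynomial (Fin 4) K) hτ hperm.2)
    (ChartDictionary.ordAlong_le_ordAlong_deletePthPowers p T _)

variable {X' : Scheme.{0}}

/-- **G2 — `MemberAtlasZL` SURVIVES THE SHEAR OF RECORD OF EVERY READING.** See the module docstring.
[cite: Hauser2010, §G (coordinate changes and cleaning)] [cite: BierstoneGrigorievMilmanWlodarczyk2011, Def. 3.1.3 (2), (4)] -/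
theorem memberAtlasZL_shear [IsAlgClosed K] [DecidableEq (AReadingL K)] (M' : MarkedIdeal X') (c : Closeds X')
    (shr : AReading K → Fin 4 × (Fin 4 → K)) (R : Finset (AReadingL K)) (hatlas : MemberAtlasZL p M' c R)
    (hperm : ∀ r ∈ R, (1 : ℕ∞) ≤ CentreBlowup.ordAlong r.1.2.1 r.1.1.F)
    (hfmtL : ∀ r ∈ R, ∀ ic ∈ r.2, ic.1 ∈ r.1.2.1 → ic.2 = 0)
    (hfmtX : ∀ r ∈ R, ∀ iv ∈ r.1.2.2.1, iv.1 ∉ r.1.2.1) (hfmtD : ∀ r ∈ R, ∀ m ∈ r.1.2.2.2, m ∉ r.1.2.1)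
    (hOK : ∀ r ∈ R, ShearOK r.1.2.1 r.2 (shr r.1))
    (hinj : ∀ r ∈ R, ∀ r' ∈ R, r.1.2.1 = r'.1.2.1 → r = r') :
    MemberAtlasZL p M' c (R.image fun r => (shearReading p shr r.1, r.2)) := by
  classical
  obtain ⟨Y, φ, ψ, hcl, hcov, hdis⟩ := hatlas
  set f : AReadingL K → AReadingL K := fun r => (shearReading p shr r.1, r.2) with hf
  have hf2 : ∀ r : AReadingL K, (f r).1.2 = r.1.2 ∧ (f r).2 = r.2 := fun r => ⟨rfl, rfl⟩
  have hfF : ∀ r : AReadingL K, (f r).1.1.F = deletePthPowers p (aeval (shearFun r.1.2.1 (shr r.1).1 (shr r.1).2) r.1.1.F) := fun r => rfl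
  -- the preimage of a sheared reading
  have hex : ∀ q : ↥(R.image f), ∃ r ∈ R, f r = (q : AReadingL K) := fun q => Finset.mem_image.mp q.2
  let ι : ↥(R.image f) → ↥R := fun q => ⟨(hex q).choose, (hex q).choose_spec.1⟩
  have hι : ∀ q : ↥(R.image f), f (ι q).1 = (q : AReadingL K) := fun q => (hex q).choose_spec.2
  have hιinj : ∀ q q' : ↥(R.image f), ι q = ι q' → q = q' := by
    intro q q' h
    apply Subtype.ext
    rw [← hι q, ← hι q', h]
  -- G1 at every reading of `R`
  have key : ∀ r : ↥R, ∃ (ψ' : Y r ⟶ P 4 K) (_ : IsOpenImmersion ψ'),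
      M'.ideal.comap (φ r) = (hypSheaf p (f r.1).1.1.F).comap ψ' ∧
      (vanishingIdeal c).comap (φ r) = (AffineCoordBlowup.𝓘Λ 4 K (insert 0 (Fin.succ '' (r.1.1.2.1 : Set (Fin 4))))).comap ψ' ∧
      (AffineCoordBlowup.CΛ 4 K (insert 0 (Fin.succ '' (r.1.1.2.1 : Set (Fin 4)))) : Set (P 4 K)) ⊆ Set.range ψ' ∧
      (∀ ic ∈ r.1.2, ∀ D : X'.IdealSheafData,
        D.comap (φ r) = (ofIdealTop (Ideal.span {(γ 4 K).symm (X ic.1.succ + C ic.2)})).comap (ψ r) →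
        D.comap (φ r) = (ofIdealTop (Ideal.span {(γ 4 K).symm (X ic.1.succ + C ic.2)})).comap ψ') ∧
      (∀ Xs : Finset (Fin 4 × K), (∀ iv ∈ Xs, iv.1 ∉ r.1.1.2.1) →
        ψ' ⁻¹' ownedSetZ r.1.1.2.1 Xs = ψ r ⁻¹' ownedSetZ r.1.1.2.1 Xs) := by
    intro r
    obtain ⟨hφ, hψ, hM, hZ, hsee, -, -⟩ := hcl r
    obtain ⟨τ, hτF, h1, h2, h3, h4⟩ := exists_algEquiv_shearFun (K := K) r.1.1.2.1 (shr r.1.1).1 (shr r.1.1).2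
    obtain ⟨hτ, hτ', hlet, hoffT⟩ := shearFun_fixes_of_shearOK (hOK r.1 r.2) (hfmtL r.1 r.2) τ h1 h2 h3 h4
    haveI := hφ
    haveI := hψ
    obtain ⟨ψ', hψ', hM', hZ', hsee', hlett, hown⟩ :=
      zigzag_shear_reading (p := p) (φ r) (ψ r) M'.ideal (vanishingIdeal c) hM hZ hsee (hperm r.1 r.2) τ hτ hτ'
    refine ⟨ψ', hψ', ?_, hZ', hsee', fun ic hic D hD => hlett ic.1 ic.2 (hlet ic hic) D hD, fun Xs hXs => hown Xs fun iv hiv =>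
      hoffT iv.1 (hXs iv hiv)⟩
    rw [hfF, ← hτF]
    exact hM'
  choose ψ' hψ' hM' hZ' hsee' hlett hown using key
  -- regions and owned sets are unchanged
  have hCΛ : ∀ r : ↥R, ψ' r ⁻¹' (AffineCoordBlowup.CΛ 4 K (insert 0 (Fin.succ '' (r.1.1.2.1 : Set (Fin 4)))) : Set (P 4 K)) =
      ψ r ⁻¹' (AffineCoordBlowup.CΛ 4 K (insert 0 (Fin.succ '' (r.1.1.2.1 : Set (Fin 4)))) : Set (P 4 K)) := fun r => by
    have h := hown r ∅ (fun iv hiv => absurd hiv (Finset.notMem_empty iv))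
    rw [ownedSetZ_empty] at h
    exact h
  have hownX : ∀ r : ↥R, ψ' r ⁻¹' ownedSetZ r.1.1.2.1 r.1.1.2.2.1 = ψ r ⁻¹' ownedSetZ r.1.1.2.1 r.1.1.2.2.1 := fun r =>
    hown r _ fun iv hiv => hfmtX r.1 r.2 iv hiv
  -- the per-reading clauses at the sheared reading `f r`
  have key2 : ∀ r : ↥R, IsOpenImmersion (φ r) ∧ IsOpenImmersion (ψ' r) ∧
      M'.ideal.comap (φ r) = (hypSheaf p (f r.1).1.1.F).comap (ψ' r) ∧
      (vanishingIdeal c).comap (φ r) =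
        (AffineCoordBlowup.𝓘Λ 4 K (insert 0 (Fin.succ '' ((f r.1).1.2.1 : Set (Fin 4))))).comap (ψ' r) ∧
      (AffineCoordBlowup.CΛ 4 K (insert 0 (Fin.succ '' ((f r.1).1.2.1 : Set (Fin 4)))) : Set (P 4 K)) ⊆ Set.range (ψ' r) ∧
      (∀ v : Fin 4 → K, IsClosed (φ r '' (ψ' r ⁻¹' ownedSetZ (f r.1).1.2.1 ((f r.1).1.2.2.2.image fun m => (m, v m))))) ∧
      ∃ (idx : X'.IdealSheafData → Fin 4) (cst_ : X'.IdealSheafData → K),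
        (∀ D ∈ M'.boundary,
          ((D.support : Set X') ∩ φ r '' (ψ' r ⁻¹'
            (AffineCoordBlowup.CΛ 4 K (insert 0 (Fin.succ '' ((f r.1).1.2.1 : Set (Fin 4)))) : Set (P 4 K)))).Nonempty →
          D.comap (φ r) = (ofIdealTop (Ideal.span {(γ 4 K).symm (X (idx D).succ + C (cst_ D))})).comap (ψ' r) ∧
            (idx D ∈ (f r.1).1.2.1 → cst_ D = 0) ∧ (idx D, cst_ D) ∈ (f r.1).2) ∧
        (∀ D₁ ∈ M'.boundary, ∀ D₂ ∈ M'.boundary,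
          ((D₁.support : Set X') ∩ φ r '' (ψ' r ⁻¹'
            (AffineCoordBlowup.CΛ 4 K (insert 0 (Fin.succ '' ((f r.1).1.2.1 : Set (Fin 4)))) : Set (P 4 K)))).Nonempty →
          ((D₂.support : Set X') ∩ φ r '' (ψ' r ⁻¹'
            (AffineCoordBlowup.CΛ 4 K (insert 0 (Fin.succ '' ((f r.1).1.2.1 : Set (Fin 4)))) : Set (P 4 K)))).Nonempty →
          idx D₁ = idx D₂ → D₁ = D₂) := by
    intro r
    obtain ⟨hφ, -, -, -, -, hfib, idx, cst_, hshape, hinjD⟩ := hcl r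
    change IsOpenImmersion (φ r) ∧ IsOpenImmersion (ψ' r) ∧
      M'.ideal.comap (φ r) = (hypSheaf p (f r.1).1.1.F).comap (ψ' r) ∧
      (vanishingIdeal c).comap (φ r) =
        (AffineCoordBlowup.𝓘Λ 4 K (insert 0 (Fin.succ '' (r.1.1.2.1 : Set (Fin 4))))).comap (ψ' r) ∧
      (AffineCoordBlowup.CΛ 4 K (insert 0 (Fin.succ '' (r.1.1.2.1 : Set (Fin 4)))) : Set (P 4 K)) ⊆ Set.range (ψ' r) ∧
      (∀ v : Fin 4 → K, IsClosed (φ r '' (ψ' r ⁻¹' ownedSetZ r.1.1.2.1 (r.1.1.2.2.2.image fun m => (m, v m))))) ∧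
      ∃ (idx : X'.IdealSheafData → Fin 4) (cst_ : X'.IdealSheafData → K),
        (∀ D ∈ M'.boundary,
          ((D.support : Set X') ∩ φ r '' (ψ' r ⁻¹'
            (AffineCoordBlowup.CΛ 4 K (insert 0 (Fin.succ '' (r.1.1.2.1 : Set (Fin 4)))) : Set (P 4 K)))).Nonempty →
          D.comap (φ r) = (ofIdealTop (Ideal.span {(γ 4 K).symm (X (idx D).succ + C (cst_ D))})).comap (ψ' r) ∧
            (idx D ∈ r.1.1.2.1 → cst_ D = 0) ∧ (idx D, cst_ D) ∈ r.1.2) ∧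
        (∀ D₁ ∈ M'.boundary, ∀ D₂ ∈ M'.boundary,
          ((D₁.support : Set X') ∩ φ r '' (ψ' r ⁻¹'
            (AffineCoordBlowup.CΛ 4 K (insert 0 (Fin.succ '' (r.1.1.2.1 : Set (Fin 4)))) : Set (P 4 K)))).Nonempty →
          ((D₂.support : Set X') ∩ φ r '' (ψ' r ⁻¹'
            (AffineCoordBlowup.CΛ 4 K (insert 0 (Fin.succ '' (r.1.1.2.1 : Set (Fin 4)))) : Set (P 4 K)))).Nonempty →
          idx D₁ = idx D₂ → D₁ = D₂)
    rw [hCΛ r]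
    refine ⟨hφ, hψ' r, hM' r, hZ' r, hsee' r, fun v => ?_, idx, cst_, fun D hD hne => ?_, hinjD⟩
    · rw [hown r _ (fun iv hiv => ?_)]
      · exact hfib v
      · obtain ⟨m, hm, rfl⟩ := Finset.mem_image.mp hiv
        exact hfmtD r.1 r.2 m hm
    · obtain ⟨hread, hzero, hmem⟩ := hshape D hD hne
      exact ⟨hlett r _ hmem D hread, hzero, hmem⟩
  -- the chosen preimage of `f r` is `r`
  have hιf : ∀ r : ↥R, ι ⟨f r.1, Finset.mem_image_of_mem f r.2⟩ = r := by
    intro r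
    apply Subtype.ext
    have h := hι ⟨f r.1, Finset.mem_image_of_mem f r.2⟩
    have h12 := congrArg (fun x : AReadingL K => x.1.2.1) h
    exact hinj _ (ι ⟨f r.1, Finset.mem_image_of_mem f r.2⟩).2 _ r.2 h12
  refine ⟨fun q => Y (ι q), fun q => φ (ι q), fun q => ψ' (ι q), fun q => ?_, ?_, fun q q' hne => ?_⟩
  · -- the per-reading clauses, read at the preimage `ι q`
    have h := key2 (ι q)
    rw [hι q] at h
    exact h
  · -- the cover
    intro x hx
    obtain ⟨r, hxr⟩ := Set.mem_iUnion.mp (hcov hx)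
    refine Set.mem_iUnion.mpr ⟨⟨f r.1, Finset.mem_image_of_mem f r.2⟩, ?_⟩
    have key : ∀ q' : ↥R, q' = r → x ∈ φ q' '' (ψ' q' ⁻¹' ownedSetZ (f r.1).1.2.1 (f r.1).1.2.2.1) := by
      intro q' hq'
      rw [hq']
      change x ∈ φ r '' (ψ' r ⁻¹' ownedSetZ r.1.1.2.1 r.1.1.2.2.1)
      rw [hownX r]; exact hxr
    exact key _ (hιf r)
  · -- disjointness
    have hne' : ι q ≠ ι q' := fun h => hne (hιinj q q' h)
    have h := hdis (ι q) (ι q') hne'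
    rw [← hownX (ι q), ← hownX (ι q')] at h
    have e1 : (q : AReadingL K) = f (ι q).1 := (hι q).symm
    have e2 : (q' : AReadingL K) = f (ι q').1 := (hι q').symm
    rw [e1, e2]
    exact h

end ShearMember

end Equimultiple

end Summit.ResolutionOfSingularities.ResolutionOfSingularities.Theorems.PIDim4

end
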